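import Summits.QuantumFields.YangMills.Theorems.UnitScaleTiltProp8ChartLocality
import Summits.QuantumFields.YangMills.Theorems.UnitScaleTiltProp8ChartDiff
import HarnessLib

/-!
# Route `UnitScaleTilt`, crux K1 child «MinimiserStabilityRegPr» (stmt-QuantumFields-19200), stub V2′ `stub_halvingStep` — **THE (X2-C′) COLUMN LETTER OF THE
# CHART REMAINDER FROM THE PER-BOND KERNEL (157)** (owner WANTED №g26-1 row (X2), residue (X2-C′); ★★OWNER g26 ASSIGNMENTS 10 (b)∕11 (c))

Cell `ym3-torus` (HUMAN RULING D-0037: YM₃ on the torus is ladder rung R3, not the Clay problem), width seat `ym-ust-19936-w8` gen 0.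
`--supports stmt-QuantumFields-19200 --as helper`; def-free, 0 sorry, standard axioms.

WHY.  ✓ p607131 `DressingTransposeLetters.X2D_letter` reduces the dressing-term transposes (X2) of [Balaban1985Variational] (73)∕(85)–(89) to two dual-weight
COLUMN letters; the one for `C′ = fderiv ℂ C (ΨY)`, `C = chartLog η D − fderiv ℂ (chartLog η D) 0` the chart remainder of record (P3 ✓ `Prop8Chart.ChartRemainderAt`),
reads `hCcol : ∀ δ, Σ_i u_i·‖C′δ i‖ ≤ c₃·Σ_b (w 3 b)⁻¹·‖δ b‖`, `u_i = η⁻³(L^{j(i)}η)⁻¹` (WEIGHT OF RECORD, owner ACK 12).  Print's supplier is (72) =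
[Balaban1985Averaging] Prop. 5 (157) *«|(δ∕δA_b)C_k(U₀, A, c)| ≦ C₃|A|»*, a PER-BOND kernel, zero unless `b ⊂ Bᵏ(c₋) ∪ Bᵏ(c₊)` — typed by lit-balaban for its ℤᵈ
objects (`B7Prop5Flat.prop5_flat_induction`), NOT for the torus chart `chartLog` (WANTED №g26-2).  THIS FILE: the knit (X2-C′) ⇐ (157) — all lattice bookkeeping.
WHAT (def-free).  §1 `fderiv_apply_eq_zero_of_const_line`.  §2 DERIVATIVE LOCALITY of `chartLog` and of `C` at ANY differentiability point (`chartLog_add_single_of_not_read`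
from ✓ `chartLog_congr`, `fderiv_chartLog_zero_single_of_not_read`, ★ `fderiv_chartRemainder_single_of_not_read`: `fderiv ℂ C Y (e_b M) i = 0` unless both `Bʲ(b₋), Bʲ(b₊)`
are end-points of `i = (j, c)`).  §3 ★ `l1col_of_kernel_count` (abstract: locality + per-bond kernel + column count ⟹ column letter).  §4 the column count on `BondIdx D`:
`card_srcReaders_level_le` (≤ 2d readers per level), ★ `sum_srcReaders_geom_le` (`Σ_{i reads b} x^{j(i)} ≤ 2d·x^{lev b}∕(1 − x)`, nestedness only via ✓ `levOf_le_of_read`).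
§5 ★★ `hCcol_of_kernel157` ∕ ★★ `hCcol_fderiv_of_kernel157` — the (X2-C′) letter of `X2D_letter` VERBATIM (`c₃ := 7C₃♭ρ`, k-uniform) from the DISPLAYED kernel row
(X2-C′-KERNEL) `‖C′(Pi.single b M) i‖ ≤ C₃♭·ρ·η·(L^{j(i)})⁻²·‖M‖` (locality a hypothesis in the first, DISCHARGED by §2 in the second).
HONEST SCOPE.  Bookkeeping; the analytic row (X2-C′-KERNEL) = [B7] (157) for `chartLog` on the torus stays displayed (WANTED №g26-2); nothing of P3∕(44)∕(73) is proved.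
NOT a claim about the stub, the crux, the rung or the mass gap.

References: T. Bałaban, CMP **102** (1985) 277–309 [Balaban1985Variational] (47)–(49) p.285, (72)–(73) p.289, (85)–(89) p.291; CMP **98** (1985) 17–51
[Balaban1985Averaging] Prop. 5 (156)–(157) p.42, (140)–(141) p.39; CMP **96** (1984) 223–250 [Balaban1984PropagatorsII] (2.3)–(2.4) p.224.
-/

set_option autoImplicit false

noncomputable section

open scoped BigOperators Matrix.Norms.L2Operator
open Filter Topology
namespace Summit.QuantumFields.YangMills.Theorems.ChartRemainderColumnLetter
open Literature.MathematicalPhysics.QuantumFieldTheory.Balaban1983to89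
open B6SectADomainsV1 (Domains)
open B6SectAOperatorsV1 (BondIdx)
open B5Eq118OneStroke (iterBlockOf)
open B11Eq115Space (levOf)
open T3ContinuumYM3Torus (T3Family)
open Summit.QuantumFields.YangMills.Theorems.FlatCubeOpsText (IsLevWeight)
open Summit.QuantumFields.YangMills.Theorems.Prop8Chart (chartLog chartLog_congr levOf_le_of_read differentiableAt_chartLog_zero)
/-! ## §1 A component constant along a line has zero derivative in that direction -/
section LineConst
variable {E F : Type*} [NormedAddCommGroup E] [NormedSpace ℂ E] [NormedAddCommGroup F] [NormedSpace ℂ F]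
/-- If `f : E → (ι → F)` is differentiable at `x` and its `i`-th component is constant along the line `t ↦ x + t•v`, then `(fderiv ℂ f x v) i = 0` (uniqueness of
the line derivative). [folklore] -/
theorem fderiv_apply_eq_zero_of_const_line {ι : Type*} [Fintype ι] (f : E → ι → F) (x v : E) (i : ι) (hf : DifferentiableAt ℂ f x)
    (hconst : ∀ t : ℂ, f (x + t • v) i = f x i) : fderiv ℂ f x v i = 0 := by
  have hg : DifferentiableAt ℂ (fun y => f y i) x := differentiableAt_pi.1 hf i
  have h1 : HasLineDerivAt ℂ (fun y => f y i) (fderiv ℂ (fun y => f y i) x v) x v := hg.hasFDerivAt.hasLineDerivAt v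
  have h2 : HasLineDerivAt ℂ (fun y => f y i) 0 x v := by
    show HasDerivAt (fun t : ℂ => f (x + t • v) i) 0 0
    rw [show (fun t : ℂ => f (x + t • v) i) = fun _ => f x i from funext hconst]
    exact hasDerivAt_const _ _
  have h3 : fderiv ℂ (fun y => f y i) x v = 0 := h1.unique h2
  rw [fderiv_apply hf i] at h3
  simpa only [ContinuousLinearMap.comp_apply, ContinuousLinearMap.proj_apply] using h3
end LineConst

/-! ## §2 Derivative locality of the chart `chartLog` and of its remainder `C = chartLog − D(chartLog)(0)` -/
section Locality
variable {P : Params} [DecidableEq (PBond P 0)] {𝔸 : Type*} [NormedRing 𝔸] [NormedAlgebra ℂ 𝔸] [CompleteSpace 𝔸]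
/-- **A SINGLE-BOND PERTURBATION OUTSIDE THE READ SET DOES NOT CHANGE THE CHART AT THE INDEX** (`chartLog_congr`): if `b` is not read by `i = (j, c)` — not both of
`Bʲ(b₋), Bʲ(b₊)` lie in `{c₋, c₊}` — then `chartLog η D (Y + e_b M) i = chartLog η D Y i`. [cite: Balaban1985Averaging, Prop. 4 p.38; Balaban1985Variational, (156) p.302] -/
theorem chartLog_add_single_of_not_read (η : ℝ) (D : Domains P) (Y : PBond P 0 → 𝔸) (b : PBond P 0) (M : 𝔸) (i : BondIdx D)
    (hnot : ¬ ((iterBlockOf (i.1.1 : ℕ) b.src = i.1.2.src ∨ iterBlockOf (i.1.1 : ℕ) b.src = i.1.2.tgt) ∧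
      (iterBlockOf (i.1.1 : ℕ) b.tgt = i.1.2.src ∨ iterBlockOf (i.1.1 : ℕ) b.tgt = i.1.2.tgt))) :
    chartLog η D (Y + Pi.single b M) i = chartLog η D Y i := by
  refine chartLog_congr η D i fun b' hs ht => ?_
  rw [Pi.add_apply]
  by_cases hb : b' = b
  · subst hb; exact absurd ⟨hs, ht⟩ hnot
  · rw [Pi.single_eq_of_ne hb, add_zero]

/-- **THE LINEARISED CHART DOES NOT SEE UNREAD BONDS**: `fderiv ℂ (chartLog η D) 0 (e_b M) i = 0` for `b` outside the read set of `i` (the chart is differentiable at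
the flat point, ✓ `differentiableAt_chartLog_zero`). [cite: Balaban1985Averaging, (140)-(141) p.39, (147) p.40] -/
theorem fderiv_chartLog_zero_single_of_not_read (η : ℝ) (D : Domains P) (b : PBond P 0) (M : 𝔸) (i : BondIdx D)
    (hnot : ¬ ((iterBlockOf (i.1.1 : ℕ) b.src = i.1.2.src ∨ iterBlockOf (i.1.1 : ℕ) b.src = i.1.2.tgt) ∧
      (iterBlockOf (i.1.1 : ℕ) b.tgt = i.1.2.src ∨ iterBlockOf (i.1.1 : ℕ) b.tgt = i.1.2.tgt))) :
    fderiv ℂ (chartLog η D : (PBond P 0 → 𝔸) → BondIdx D → 𝔸) 0 (Pi.single b M) i = 0 := by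
  refine fderiv_apply_eq_zero_of_const_line (chartLog η D : (PBond P 0 → 𝔸) → BondIdx D → 𝔸) 0 (Pi.single b M) i
    (differentiableAt_chartLog_zero η D) fun t => ?_
  rw [show t • (Pi.single b M : PBond P 0 → 𝔸) = Pi.single b (t • M) from (Pi.single_smul' b t M).symm]
  exact chartLog_add_single_of_not_read η D 0 b (t • M) i hnot

/-- ★ **DERIVATIVE LOCALITY OF THE CHART REMAINDER** `C = chartLog η D − fderiv ℂ (chartLog η D) 0` at ANY point `Y` where the chart is differentiable (✓ hCd on the
weighted ball): for a fine bond `b` outside the read set of the index `i`, `fderiv ℂ C Y (e_b M) i = 0` — print's *«|(δ∕δA_b)C_k(U₀, A, c)| … b ⊂ Bᵏ(c₋) ∪ Bᵏ(c₊)»*.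
[cite: Balaban1985Averaging, Prop. 5 (157) p.42; Balaban1985Variational, (72)-(73) p.289] -/
theorem fderiv_chartRemainder_single_of_not_read (η : ℝ) (D : Domains P) {Y : PBond P 0 → 𝔸}
    (hY : DifferentiableAt ℂ (chartLog η D : (PBond P 0 → 𝔸) → BondIdx D → 𝔸) Y) (b : PBond P 0) (M : 𝔸) (i : BondIdx D)
    (hnot : ¬ ((iterBlockOf (i.1.1 : ℕ) b.src = i.1.2.src ∨ iterBlockOf (i.1.1 : ℕ) b.src = i.1.2.tgt) ∧
      (iterBlockOf (i.1.1 : ℕ) b.tgt = i.1.2.src ∨ iterBlockOf (i.1.1 : ℕ) b.tgt = i.1.2.tgt))) :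
    fderiv ℂ (fun A : PBond P 0 → 𝔸 => chartLog η D A - fderiv ℂ (chartLog η D : (PBond P 0 → 𝔸) → BondIdx D → 𝔸) 0 A) Y (Pi.single b M) i = 0 := by
  have hdiff : DifferentiableAt ℂ (fun A : PBond P 0 → 𝔸 => chartLog η D A - fderiv ℂ (chartLog η D : (PBond P 0 → 𝔸) → BondIdx D → 𝔸) 0 A) Y :=
    hY.sub (fderiv ℂ (chartLog η D : (PBond P 0 → 𝔸) → BondIdx D → 𝔸) 0).differentiableAt
  refine fderiv_apply_eq_zero_of_const_line
    (fun A : PBond P 0 → 𝔸 => chartLog η D A - fderiv ℂ (chartLog η D : (PBond P 0 → 𝔸) → BondIdx D → 𝔸) 0 A) Y (Pi.single b M) i hdiff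
    fun t => ?_
  simp only [Pi.sub_apply, map_add, map_smul, Pi.add_apply, Pi.smul_apply]
  rw [fderiv_chartLog_zero_single_of_not_read η D b M i hnot, smul_zero, add_zero,
    show t • (Pi.single b M : PBond P 0 → 𝔸) = Pi.single b (t • M) from (Pi.single_smul' b t M).symm,
    chartLog_add_single_of_not_read η D Y b (t • M) i hnot]
end Locality

/-! ## §3 The abstract column knit: locality + per-bond kernel + column count ⟹ the dual-weight column letter -/
section Abstract
variable {ι I : Type*} [Fintype ι] [DecidableEq ι] [Fintype I] {V : Type*} [SeminormedAddCommGroup V] [NormedSpace ℂ V]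
/-- ★ **COLUMN LETTER FROM A PER-BOND KERNEL ROW**: for a ℂ-linear `C′`, a read relation `R`, dual weights `u ≥ 0` (index side), `v` (fine side): if
`C′(e_b M) i = 0` unless `R i b` (locality), `u_i·‖C′(e_b M) i‖ ≤ κ_i·‖M‖` when `R i b` (kernel row), and `Σ_{i : R i b} κ_i ≤ c·v_b` (column count), then
`Σ_i u_i·‖C′δ i‖ ≤ c·Σ_b v_b·‖δ b‖` for every `δ` (expand `δ = Σ_b e_b(δ b)`, triangle, swap the sums). [cite: Balaban1985Variational, (73) p.289, (85) p.291] -/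
theorem l1col_of_kernel_count (C' : (ι → V) →ₗ[ℂ] (I → V)) (R : I → ι → Prop) [∀ i b, Decidable (R i b)] (u κ : I → ℝ) (v : ι → ℝ) {c : ℝ}
    (hu : ∀ i, 0 ≤ u i)
    (h0 : ∀ (b : ι) (M : V) (i : I), ¬ R i b → C' (Pi.single b M) i = 0)
    (hK : ∀ (b : ι) (M : V) (i : I), R i b → u i * ‖C' (Pi.single b M) i‖ ≤ κ i * ‖M‖)
    (hcount : ∀ b, ∑ i, (if R i b then κ i else 0) ≤ c * v b) (δ : ι → V) :
    ∑ i, u i * ‖C' δ i‖ ≤ c * ∑ b, v b * ‖δ b‖ := by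
  have hδ : δ = ∑ b, (Pi.single b (δ b) : ι → V) := (Finset.univ_sum_single δ).symm
  have happly : ∀ i, C' δ i = ∑ b, C' (Pi.single b (δ b)) i := by
    intro i
    conv_lhs => rw [hδ]
    rw [map_sum, Finset.sum_apply]
  have hrow : ∀ i, u i * ‖C' δ i‖ ≤ ∑ b, (if R i b then κ i else 0) * ‖δ b‖ := by
    intro i
    rw [happly i]
    calc u i * ‖∑ b, C' (Pi.single b (δ b)) i‖ ≤ u i * ∑ b, ‖C' (Pi.single b (δ b)) i‖ := mul_le_mul_of_nonneg_left (norm_sum_le _ _) (hu i)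
      _ = ∑ b, u i * ‖C' (Pi.single b (δ b)) i‖ := Finset.mul_sum _ _ _
      _ ≤ ∑ b, (if R i b then κ i else 0) * ‖δ b‖ := Finset.sum_le_sum fun b _ => by
          by_cases hR : R i b
          · rw [if_pos hR]; exact hK b (δ b) i hR
          · rw [if_neg hR, h0 b (δ b) i hR, norm_zero, mul_zero, zero_mul]
  calc ∑ i, u i * ‖C' δ i‖ ≤ ∑ i, ∑ b, (if R i b then κ i else 0) * ‖δ b‖ := Finset.sum_le_sum fun i _ => hrow i
    _ = ∑ b, (∑ i, (if R i b then κ i else 0)) * ‖δ b‖ := by rw [Finset.sum_comm]; exact Finset.sum_congr rfl fun b _ => (Finset.sum_mul _ _ _).symm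
    _ ≤ ∑ b, c * v b * ‖δ b‖ := Finset.sum_le_sum fun b _ => mul_le_mul_of_nonneg_right (hcount b) (norm_nonneg _)
    _ = c * ∑ b, v b * ‖δ b‖ := by rw [Finset.mul_sum]; exact Finset.sum_congr rfl fun b _ => by ring
end Abstract

/-! ## §4 The column count on the index set `BondIdx D` -/
section Count
variable {P : Params} (D : Domains P)
/-- `(x + e_μ) − e_μ = x` on the torus. [folklore] -/
private theorem unshift_shift' {i : ℕ} (x : Site P i) (μ : Fin P.d) : (x.shift μ).unshift μ = x := by
  funext ν
  by_cases h : ν = μ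
  · subst h; simp [Site.shift, Site.unshift]
  · simp [Site.shift, Site.unshift, Function.update_of_ne h]

/-- **AT EACH LEVEL AT MOST `2d` INDEX BONDS HAVE A GIVEN BLOCK AS AN END-POINT**: the index bonds `i = (j, c)` of level `j` with `c₋ = Bʲ(b₋)` or `c₊ = Bʲ(b₋)` are
among `⟨Bʲ(b₋), μ⟩`, `⟨Bʲ(b₋) − e_μ, μ⟩`, `μ < d`. [cite: Balaban1984PropagatorsII, (2.3) p.224; Balaban1985Averaging, (140)-(141) p.39] -/
theorem card_srcReaders_level_le (b : PBond P 0) (j : Fin (D.k + 1)) :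
    (Finset.univ.filter fun i : BondIdx D =>
        i.1.1 = j ∧ (iterBlockOf (i.1.1 : ℕ) b.src = i.1.2.src ∨ iterBlockOf (i.1.1 : ℕ) b.src = i.1.2.tgt)).card ≤ 2 * P.d := by
  set sS : Finset (BondIdx D) := Finset.univ.filter fun i : BondIdx D => i.1.1 = j ∧ iterBlockOf (i.1.1 : ℕ) b.src = i.1.2.src with hsS
  set sT : Finset (BondIdx D) := Finset.univ.filter fun i : BondIdx D => i.1.1 = j ∧ iterBlockOf (i.1.1 : ℕ) b.src = i.1.2.tgt with hsT
  have hsub : (Finset.univ.filter fun i : BondIdx D =>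
      i.1.1 = j ∧ (iterBlockOf (i.1.1 : ℕ) b.src = i.1.2.src ∨ iterBlockOf (i.1.1 : ℕ) b.src = i.1.2.tgt)).card ≤ sS.card + sT.card := by
    rw [Finset.card_filter, hsS, hsT, Finset.card_filter, Finset.card_filter, ← Finset.sum_add_distrib]
    refine Finset.sum_le_sum fun i _ => ?_
    by_cases hp : i.1.1 = j ∧ (iterBlockOf (i.1.1 : ℕ) b.src = i.1.2.src ∨ iterBlockOf (i.1.1 : ℕ) b.src = i.1.2.tgt)
    · rw [if_pos hp]
      rcases hp with ⟨hj, hA | hB⟩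
      · have h1 : (if i.1.1 = j ∧ iterBlockOf (i.1.1 : ℕ) b.src = i.1.2.src then 1 else 0) = 1 := if_pos ⟨hj, hA⟩
        rw [h1]; split_ifs <;> omega
      · have h2 : (if i.1.1 = j ∧ iterBlockOf (i.1.1 : ℕ) b.src = i.1.2.tgt then 1 else 0) = 1 := if_pos ⟨hj, hB⟩
        rw [h2]; split_ifs <;> omega
    · rw [if_neg hp]; exact Nat.zero_le _
  have hS : sS.card ≤ P.d := by
    have h := Finset.card_le_card_of_injOn (fun i : BondIdx D => i.1.2.dir) (fun i _ => Finset.mem_univ _) (s := sS) (t := Finset.univ) ?_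
    · simpa using h
    intro i₁ h₁ i₂ h₂ hdir
    obtain ⟨⟨j₁, c₁⟩, p₁⟩ := i₁
    obtain ⟨⟨j₂, c₂⟩, p₂⟩ := i₂
    simp only [hsS, Finset.mem_coe, Finset.mem_filter, Finset.mem_univ, true_and] at h₁ h₂
    simp only at hdir
    obtain ⟨rfl, hc₁⟩ := h₁
    obtain ⟨hj₂, hc₂⟩ := h₂
    subst hj₂
    have hc : c₁ = c₂ := by
      cases c₁; cases c₂
      simp only at hc₁ hc₂ hdir
      simp only [PBond.mk.injEq]
      exact ⟨hc₁.symm.trans hc₂, hdir⟩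
    subst hc
    rfl
  have hT : sT.card ≤ P.d := by
    have h := Finset.card_le_card_of_injOn (fun i : BondIdx D => i.1.2.dir) (fun i _ => Finset.mem_univ _) (s := sT) (t := Finset.univ) ?_
    · simpa using h
    intro i₁ h₁ i₂ h₂ hdir
    obtain ⟨⟨j₁, c₁⟩, p₁⟩ := i₁
    obtain ⟨⟨j₂, c₂⟩, p₂⟩ := i₂
    simp only [hsT, Finset.mem_coe, Finset.mem_filter, Finset.mem_univ, true_and] at h₁ h₂
    simp only at hdir
    obtain ⟨rfl, hc₁⟩ := h₁
    obtain ⟨hj₂, hc₂⟩ := h₂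
    subst hj₂
    have hsrc₁ : c₁.src = (iterBlockOf _ b.src).unshift c₁.dir := by
      rw [hc₁]; exact (unshift_shift' c₁.src c₁.dir).symm
    have hsrc₂ : c₂.src = (iterBlockOf _ b.src).unshift c₂.dir := by
      rw [hc₂]; exact (unshift_shift' c₂.src c₂.dir).symm
    have hc : c₁ = c₂ := by
      have hd : c₁.dir = c₂.dir := hdir
      cases c₁; cases c₂
      simp only [PBond.mk.injEq]
      simp only at hd hsrc₁ hsrc₂
      subst hd
      exact ⟨hsrc₁.trans hsrc₂.symm, rfl⟩
    subst hc
    rfl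
  calc _ ≤ sS.card + sT.card := hsub
    _ ≤ P.d + P.d := add_le_add hS hT
    _ = 2 * P.d := by ring

/-- ★ **THE LEVEL-GEOMETRIC COLUMN COUNT**: for a fine bond `b` with territory level `lev b = levOf Ω D.k b₋` and `0 ≤ x < 1`,
`Σ_{i : Bʲ⁽ⁱ⁾(b₋) ∈ {c₋, c₊}} x^{j(i)} ≤ 2d·x^{lev b}∕(1 − x)` — every reading index has level `≥ lev b` (✓ `levOf_le_of_read`, nestedness only), at most `2d` per level,
geometric tail. [cite: Balaban1984PropagatorsII, (2.3)-(2.4) p.224; Balaban1985Averaging, (141) p.39] -/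
theorem sum_srcReaders_geom_le (b : PBond P 0) {x : ℝ} (hx0 : 0 ≤ x) (hx1 : x < 1) :
    ∑ i : BondIdx D, (if (iterBlockOf (i.1.1 : ℕ) b.src = i.1.2.src ∨ iterBlockOf (i.1.1 : ℕ) b.src = i.1.2.tgt) then x ^ (i.1.1 : ℕ) else 0)
      ≤ 2 * P.d * (x ^ levOf (fun j => {y : Site P 0 | D.InOm j y}) D.k b.src / (1 - x)) := by
  set lev : ℕ := levOf (fun j => {y : Site P 0 | D.InOm j y}) D.k b.src with hlev
  set s : Finset (BondIdx D) := Finset.univ.filter fun i : BondIdx D =>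
    iterBlockOf (i.1.1 : ℕ) b.src = i.1.2.src ∨ iterBlockOf (i.1.1 : ℕ) b.src = i.1.2.tgt with hs
  have h1 : ∑ i : BondIdx D, (if (iterBlockOf (i.1.1 : ℕ) b.src = i.1.2.src ∨ iterBlockOf (i.1.1 : ℕ) b.src = i.1.2.tgt) then x ^ (i.1.1 : ℕ) else 0)
      = ∑ i ∈ s, x ^ ((i.1.1 : Fin (D.k + 1)) : ℕ) := by
    rw [hs, Finset.sum_filter]
  have h2 : ∑ i ∈ s, x ^ ((i.1.1 : Fin (D.k + 1)) : ℕ) = ∑ j : Fin (D.k + 1), ∑ i ∈ s with i.1.1 = j, x ^ (j : ℕ) :=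
    (Finset.sum_fiberwise_of_maps_to' (s := s) (t := Finset.univ) (g := fun i : BondIdx D => i.1.1) (fun i _ => Finset.mem_univ _)
      (fun j : Fin (D.k + 1) => x ^ (j : ℕ))).symm
  have h3 : ∀ j : Fin (D.k + 1), ∑ i ∈ s with i.1.1 = j, x ^ (j : ℕ) ≤ (if lev ≤ (j : ℕ) then 2 * (P.d : ℝ) * x ^ (j : ℕ) else 0) := by
    intro j
    rw [Finset.sum_const, nsmul_eq_mul]
    by_cases hj : lev ≤ (j : ℕ)
    · rw [if_pos hj]
      refine mul_le_mul_of_nonneg_right ?_ (pow_nonneg hx0 _)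
      have hc : (s.filter fun i : BondIdx D => i.1.1 = j).card ≤ 2 * P.d := by
        refine le_trans (Finset.card_le_card fun i hi => ?_) (card_srcReaders_level_le D b j)
        simp only [hs, Finset.mem_filter, Finset.mem_univ, true_and] at hi ⊢
        exact ⟨hi.2, hi.1⟩
      exact_mod_cast hc
    · rw [if_neg hj]
      have hempty : (s.filter fun i : BondIdx D => i.1.1 = j) = ∅ := by
        refine Finset.filter_eq_empty_iff.2 fun i hi hij => hj ?_
        simp only [hs, Finset.mem_filter, Finset.mem_univ, true_and] at hi
        have h := levOf_le_of_read D i b.src hi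
        rw [hij] at h
        exact h
      rw [hempty, Finset.card_empty, Nat.cast_zero, zero_mul]
  have h4 : ∑ j : Fin (D.k + 1), (if lev ≤ (j : ℕ) then 2 * (P.d : ℝ) * x ^ (j : ℕ) else 0) ≤ 2 * P.d * (x ^ lev / (1 - x)) := by
    rw [Fin.sum_univ_eq_sum_range (fun m => if lev ≤ m then 2 * (P.d : ℝ) * x ^ m else 0) (D.k + 1), ← Finset.sum_filter]
    have hsub : (Finset.range (D.k + 1)).filter (fun m => lev ≤ m) ⊆ Finset.Ico lev (D.k + 1) := by
      intro m hm
      rw [Finset.mem_filter, Finset.mem_range] at hm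
      exact Finset.mem_Ico.2 ⟨hm.2, hm.1⟩
    calc ∑ m ∈ (Finset.range (D.k + 1)).filter (fun m => lev ≤ m), 2 * (P.d : ℝ) * x ^ m
        ≤ ∑ m ∈ Finset.Ico lev (D.k + 1), 2 * (P.d : ℝ) * x ^ m :=
          Finset.sum_le_sum_of_subset_of_nonneg hsub fun m _ _ => by positivity
      _ = 2 * P.d * ∑ m ∈ Finset.Ico lev (D.k + 1), x ^ m := by rw [Finset.mul_sum]
      _ ≤ 2 * P.d * (x ^ lev / (1 - x)) := mul_le_mul_of_nonneg_left (geom_sum_Ico_le_of_lt_one hx0 hx1) (by positivity)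
  calc _ = ∑ i ∈ s, x ^ ((i.1.1 : Fin (D.k + 1)) : ℕ) := h1
    _ = ∑ j : Fin (D.k + 1), ∑ i ∈ s with i.1.1 = j, x ^ (j : ℕ) := h2
    _ ≤ ∑ j : Fin (D.k + 1), (if lev ≤ (j : ℕ) then 2 * (P.d : ℝ) * x ^ (j : ℕ) else 0) := Finset.sum_le_sum fun j _ => h3 j
    _ ≤ 2 * P.d * (x ^ lev / (1 - x)) := h4
end Count

/-! ## §5 The (X2-C′) letter at the cube-sequence weights from the displayed kernel row (157) -/
section T3
variable (F : T3Family) (n K : ℕ) [DecidableEq (PBond (F.P K) 0)] (D : Domains (F.P K))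
/-- ★★ **(X2-C′) FROM (157) — THE COLUMN LETTER OF `X2D_letter` AT THE WEIGHT OF RECORD** `u_i = η⁻³(L^{j(i)}η)⁻¹`, `(w 3 b)⁻¹ = (L^{lev b}η)⁻³` (`η = (L⁻¹)^{K−n}`,
weights `IsLevWeight`; d = 3): for a ℂ-linear `C′` (:= `fderiv ℂ C Y`, `C` the chart remainder) with the derivative LOCALITY of §2 (hypothesis `h0`, discharged in
`hCcol_fderiv_of_kernel157`) and the DISPLAYED per-bond kernel row (X2-C′-KERNEL) `‖C′(e_b M) i‖ ≤ C₃♭·ρ·η·(L^{j(i)})⁻²·‖M‖` ([B7] (157) read at the weighted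
ball of radius `ρ`; WANTED №g26-2), one has `Σ_i u_i‖C′δ i‖ ≤ 7C₃♭ρ·Σ_b (w 3 b)⁻¹‖δ b‖` — O(ρ), k-uniform (`6·(1 − L⁻³)⁻¹ ≤ 48∕7 ≤ 7`).
[cite: Balaban1985Averaging, Prop. 5 (157) p.42; Balaban1985Variational, (72)-(73) p.289] -/
theorem hCcol_of_kernel157 (hDk : D.k = K - n) {w : ℕ → PBond (F.P K) 0 → ℝ} (hw : IsLevWeight F n K D w)
    (C' : (PBond (F.P K) 0 → Matrix (Fin 2) (Fin 2) ℂ) →ₗ[ℂ] (BondIdx D → Matrix (Fin 2) (Fin 2) ℂ)) {C₃ ρ : ℝ} (hC₃ : 0 ≤ C₃) (hρ : 0 ≤ ρ)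
    (h0 : ∀ (b : PBond (F.P K) 0) (M : Matrix (Fin 2) (Fin 2) ℂ) (i : BondIdx D),
      ¬ ((iterBlockOf (i.1.1 : ℕ) b.src = i.1.2.src ∨ iterBlockOf (i.1.1 : ℕ) b.src = i.1.2.tgt) ∧
          (iterBlockOf (i.1.1 : ℕ) b.tgt = i.1.2.src ∨ iterBlockOf (i.1.1 : ℕ) b.tgt = i.1.2.tgt)) → C' (Pi.single b M) i = 0)
    (hK : ∀ (b : PBond (F.P K) 0) (M : Matrix (Fin 2) (Fin 2) ℂ) (i : BondIdx D),
      ‖C' (Pi.single b M) i‖ ≤ C₃ * ρ * ((F.L : ℝ)⁻¹) ^ (K - n) * (((F.L : ℝ) ^ (i.1.1 : ℕ))⁻¹) ^ 2 * ‖M‖)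
    (δ : PBond (F.P K) 0 → Matrix (Fin 2) (Fin 2) ℂ) :
    ∑ i : BondIdx D, ((((F.L : ℝ)⁻¹) ^ (K - n)) ^ 3)⁻¹ * ((F.L : ℝ) ^ (i.1.1 : ℕ) * ((F.L : ℝ)⁻¹) ^ (K - n))⁻¹ * ‖C' δ i‖
      ≤ 7 * C₃ * ρ * ∑ b, (w 3 b)⁻¹ * ‖δ b‖ := by
  set L : ℝ := (F.L : ℝ) with hLdef
  set η : ℝ := (L⁻¹) ^ (K - n) with hη
  have hL2 : (2 : ℝ) ≤ L := by
    have h := F.hL.2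
    have : (2 : ℕ) ≤ F.L := h
    rw [hLdef]
    exact_mod_cast this
  have hL0 : 0 < L := by linarith
  have hη0 : 0 < η := by rw [hη]; positivity
  set x : ℝ := (L ^ 3)⁻¹ with hx
  have hx0 : 0 ≤ x := by rw [hx]; positivity
  have hx8 : x ≤ 1 / 8 := by
    rw [hx, one_div]
    have h8 : (2 : ℝ) ^ 3 ≤ L ^ 3 := pow_le_pow_left₀ (by norm_num) hL2 3
    exact inv_anti₀ (by norm_num) (by norm_num at h8 ⊢; linarith)
  have hx1 : x < 1 := by linarith
  have hgeo : 1 / (1 - x) ≤ 8 / 7 := by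
    rw [div_le_div_iff₀ (by linarith) (by norm_num)]; linarith
  have hpow3 : ∀ j : ℕ, ((L ^ j * η) ^ 3)⁻¹ = (η ^ 3)⁻¹ * x ^ j := by
    intro j
    rw [hx]
    have h3 : ((L ^ 3)⁻¹) ^ j = ((L ^ j) ^ 3)⁻¹ := by
      rw [inv_pow, ← pow_mul, ← pow_mul, mul_comm 3 j]
    rw [h3, mul_pow, mul_inv, mul_comm]
  have hker : ∀ j : ℕ, (η ^ 3)⁻¹ * (L ^ j * η)⁻¹ * (η * ((L ^ j)⁻¹) ^ 2) = ((L ^ j * η) ^ 3)⁻¹ := by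
    intro j
    have hLj : (L ^ j) ≠ 0 := pow_ne_zero _ hL0.ne'
    field_simp
  have hw3 : ∀ b : PBond (F.P K) 0, (w 3 b)⁻¹ = (η ^ 3)⁻¹ * x ^ levOf (fun j => {y : Site (F.P K) 0 | D.InOm j y}) (K - n) b.src := by
    intro b
    rw [hw 3 b]
    exact hpow3 _
  have hd : (((F.P K).d : ℕ) : ℝ) = 3 := by rw [T3Family.P_d]; norm_num
  refine l1col_of_kernel_count C'
    (fun (i : BondIdx D) (b : PBond (F.P K) 0) =>
      (iterBlockOf (i.1.1 : ℕ) b.src = i.1.2.src ∨ iterBlockOf (i.1.1 : ℕ) b.src = i.1.2.tgt) ∧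
        (iterBlockOf (i.1.1 : ℕ) b.tgt = i.1.2.src ∨ iterBlockOf (i.1.1 : ℕ) b.tgt = i.1.2.tgt))
    (fun i => ((η ^ 3)⁻¹) * (L ^ (i.1.1 : ℕ) * η)⁻¹) (fun i => C₃ * ρ * ((L ^ (i.1.1 : ℕ) * η) ^ 3)⁻¹) (fun b => (w 3 b)⁻¹)
    (fun i => by positivity) (fun b M i hR => h0 b M i hR) (fun b M i _ => ?_) (fun b => ?_) δ
  · -- kernel row × weight
    calc (η ^ 3)⁻¹ * (L ^ (i.1.1 : ℕ) * η)⁻¹ * ‖C' (Pi.single b M) i‖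
        ≤ (η ^ 3)⁻¹ * (L ^ (i.1.1 : ℕ) * η)⁻¹ * (C₃ * ρ * η * ((L ^ (i.1.1 : ℕ))⁻¹) ^ 2 * ‖M‖) :=
          mul_le_mul_of_nonneg_left (hK b M i) (by positivity)
      _ = C₃ * ρ * ((η ^ 3)⁻¹ * (L ^ (i.1.1 : ℕ) * η)⁻¹ * (η * ((L ^ (i.1.1 : ℕ))⁻¹) ^ 2)) * ‖M‖ := by ring
      _ = C₃ * ρ * ((L ^ (i.1.1 : ℕ) * η) ^ 3)⁻¹ * ‖M‖ := by rw [hker]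
  · -- column count: readers ⊆ source-readers, geometric level sum
    have hle : ∑ i : BondIdx D, (if (iterBlockOf (i.1.1 : ℕ) b.src = i.1.2.src ∨ iterBlockOf (i.1.1 : ℕ) b.src = i.1.2.tgt) ∧
          (iterBlockOf (i.1.1 : ℕ) b.tgt = i.1.2.src ∨ iterBlockOf (i.1.1 : ℕ) b.tgt = i.1.2.tgt)
          then C₃ * ρ * ((L ^ (i.1.1 : ℕ) * η) ^ 3)⁻¹ else 0)
        ≤ C₃ * ρ * (η ^ 3)⁻¹ * ∑ i : BondIdx D,
          (if (iterBlockOf (i.1.1 : ℕ) b.src = i.1.2.src ∨ iterBlockOf (i.1.1 : ℕ) b.src = i.1.2.tgt) then x ^ (i.1.1 : ℕ) else 0) := by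
      rw [Finset.mul_sum]
      refine Finset.sum_le_sum fun i _ => ?_
      by_cases hR : (iterBlockOf (i.1.1 : ℕ) b.src = i.1.2.src ∨ iterBlockOf (i.1.1 : ℕ) b.src = i.1.2.tgt) ∧
          (iterBlockOf (i.1.1 : ℕ) b.tgt = i.1.2.src ∨ iterBlockOf (i.1.1 : ℕ) b.tgt = i.1.2.tgt)
      · rw [if_pos hR, if_pos hR.1, hpow3]; exact le_of_eq (by ring)
      · rw [if_neg hR]
        split_ifs
        · positivity
        · rw [mul_zero]
    have hgeom := sum_srcReaders_geom_le D b hx0 hx1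
    have hlevEq : levOf (fun j => {y : Site (F.P K) 0 | D.InOm j y}) D.k b.src =
        levOf (fun j => {y : Site (F.P K) 0 | D.InOm j y}) (K - n) b.src := by rw [hDk]
    rw [hlevEq] at hgeom
    set lev : ℕ := levOf (fun j => {y : Site (F.P K) 0 | D.InOm j y}) (K - n) b.src with hlev
    have hxlev : 0 ≤ x ^ lev := pow_nonneg hx0 _
    have hnn : 0 ≤ C₃ * ρ * ((η ^ 3)⁻¹ * x ^ lev) := by positivity
    have hdiv : x ^ lev / (1 - x) ≤ x ^ lev * (8 / 7) := by
      rw [div_eq_mul_one_div]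
      exact mul_le_mul_of_nonneg_left hgeo hxlev
    calc _ ≤ C₃ * ρ * (η ^ 3)⁻¹ * ∑ i : BondIdx D,
          (if (iterBlockOf (i.1.1 : ℕ) b.src = i.1.2.src ∨ iterBlockOf (i.1.1 : ℕ) b.src = i.1.2.tgt) then x ^ (i.1.1 : ℕ) else 0) := hle
      _ ≤ C₃ * ρ * (η ^ 3)⁻¹ * (2 * ((F.P K).d : ℝ) * (x ^ lev / (1 - x))) := mul_le_mul_of_nonneg_left hgeom (by positivity)
      _ ≤ C₃ * ρ * (η ^ 3)⁻¹ * (2 * ((F.P K).d : ℝ) * (x ^ lev * (8 / 7))) := by gcongr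
      _ = (48 / 7) * (C₃ * ρ * ((η ^ 3)⁻¹ * x ^ lev)) := by rw [hd]; ring
      _ ≤ 7 * (C₃ * ρ * ((η ^ 3)⁻¹ * x ^ lev)) := by nlinarith [hnn]
      _ = 7 * C₃ * ρ * (w 3 b)⁻¹ := by rw [hw3 b]; ring

/-- ★★ **(X2-C′) FROM (157) AT `C′ := fderiv ℂ C Y`**, `C = chartLog η D − fderiv ℂ (chartLog η D) 0` the chart remainder of record (P3 `ChartRemainderAt`): the column
letter of `DressingTransposeLetters.X2D_letter` with the derivative LOCALITY DISCHARGED (§2, at any differentiability point `Y` of the chart — ✓ hCd on the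
weighted ball) and the per-bond kernel row (X2-C′-KERNEL) = [Balaban1985Averaging] (157) for `chartLog` on the torus DISPLAYED (WANTED №g26-2).
[cite: Balaban1985Averaging, Prop. 5 (157) p.42; Balaban1985Variational, (72)-(73) p.289, (85)-(86) p.291] -/
theorem hCcol_fderiv_of_kernel157 (hDk : D.k = K - n) {w : ℕ → PBond (F.P K) 0 → ℝ} (hw : IsLevWeight F n K D w)
    {Y : PBond (F.P K) 0 → Matrix (Fin 2) (Fin 2) ℂ}
    (hY : DifferentiableAt ℂ (chartLog (((F.L : ℝ)⁻¹) ^ (K - n)) D :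
      (PBond (F.P K) 0 → Matrix (Fin 2) (Fin 2) ℂ) → BondIdx D → Matrix (Fin 2) (Fin 2) ℂ) Y)
    {C₃ ρ : ℝ} (hC₃ : 0 ≤ C₃) (hρ : 0 ≤ ρ)
    (hK : ∀ (b : PBond (F.P K) 0) (M : Matrix (Fin 2) (Fin 2) ℂ) (i : BondIdx D),
      ‖fderiv ℂ (fun A : PBond (F.P K) 0 → Matrix (Fin 2) (Fin 2) ℂ =>
            chartLog (((F.L : ℝ)⁻¹) ^ (K - n)) D A -
              fderiv ℂ (chartLog (((F.L : ℝ)⁻¹) ^ (K - n)) D :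
                (PBond (F.P K) 0 → Matrix (Fin 2) (Fin 2) ℂ) → BondIdx D → Matrix (Fin 2) (Fin 2) ℂ) 0 A) Y (Pi.single b M) i‖
        ≤ C₃ * ρ * ((F.L : ℝ)⁻¹) ^ (K - n) * (((F.L : ℝ) ^ (i.1.1 : ℕ))⁻¹) ^ 2 * ‖M‖)
    (δ : PBond (F.P K) 0 → Matrix (Fin 2) (Fin 2) ℂ) :
    ∑ i : BondIdx D, ((((F.L : ℝ)⁻¹) ^ (K - n)) ^ 3)⁻¹ * ((F.L : ℝ) ^ (i.1.1 : ℕ) * ((F.L : ℝ)⁻¹) ^ (K - n))⁻¹ *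
        ‖fderiv ℂ (fun A : PBond (F.P K) 0 → Matrix (Fin 2) (Fin 2) ℂ =>
            chartLog (((F.L : ℝ)⁻¹) ^ (K - n)) D A -
              fderiv ℂ (chartLog (((F.L : ℝ)⁻¹) ^ (K - n)) D :
                (PBond (F.P K) 0 → Matrix (Fin 2) (Fin 2) ℂ) → BondIdx D → Matrix (Fin 2) (Fin 2) ℂ) 0 A) Y δ i‖
      ≤ 7 * C₃ * ρ * ∑ b, (w 3 b)⁻¹ * ‖δ b‖ :=
  hCcol_of_kernel157 F n K D hDk hw
    (fderiv ℂ (fun A : PBond (F.P K) 0 → Matrix (Fin 2) (Fin 2) ℂ =>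
        chartLog (((F.L : ℝ)⁻¹) ^ (K - n)) D A -
          fderiv ℂ (chartLog (((F.L : ℝ)⁻¹) ^ (K - n)) D :
            (PBond (F.P K) 0 → Matrix (Fin 2) (Fin 2) ℂ) → BondIdx D → Matrix (Fin 2) (Fin 2) ℂ) 0 A) Y :
      (PBond (F.P K) 0 → Matrix (Fin 2) (Fin 2) ℂ) →ₗ[ℂ] (BondIdx D → Matrix (Fin 2) (Fin 2) ℂ))
    hC₃ hρ (fun b M i hnot => fderiv_chartRemainder_single_of_not_read _ D hY b M i hnot) hK δ
end T3
end Summit.QuantumFields.YangMills.Theorems.ChartRemainderColumnLetter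

end
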